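import Summits.Ventures.HodgeRepro.Faces
import Summits.Ventures.HodgeRepro.RouteCReflexModel
import Summits.Ventures.HodgeRepro.RouteCCosetModel

/-!
# Closer C5′ (Route C) as Lean statements: the printed clauses in an abstract vocabulary over the
finite-group model, and the face discharge theorem

Blind re-derivation cell `pub-hodge-repro`, seat `night-1`.  `route/ROUTE.md` §4 item 1 (C5′) and
`route/ROUTE-C.md` derive S4 for a corner product `B` from printed theorems glued by two elementary lemmas.
This file writes that derivation as ONE Lean theorem whose hypotheses are the printed clauses, each a
`Prop` in an abstract vocabulary (`Vocab`), and whose model-side inputs (the face's corner classes, the Liu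
types and their reflex fields, the codimension range) are the kernel theorems of `RouteCReflexModel.lean`
and of the face file.  Nothing geometric is constructed: `Vocab` only NAMES the objects the printed
statements speak about (varieties, Hodge classes being algebraic, surjective morphisms, Liu's Shimura
varieties `X_K` and CM varieties `A_μ`, isogeny factors), and every clause is the printed sentence read in
those names, with its locator.  The theorems say exactly: IF the printed clauses hold in the vocabulary,
THEN the face's Weil line is algebraic — the conditional implication that `ROUTE.md` §4 item 1 (v2.3 §10.6)
asks the report to state («never as a theorem of ours»).  Nothing here says anything about the status of
the Hodge conjecture for CM abelian varieties, which is NOT proved.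

## The vocabulary (`Vocab G c`)

`E` a Galois CM field with group `G` and complex conjugation `c`, `Hom(E, ℂ) ≅ G` (`CMType.lean`).
* `Var` — smooth projective varieties over `ℂ` (up to the identifications the clauses make);
  `HC X k` — «every Hodge class in `H^{2k}(X, ℚ)` is algebraic» (BMM §1.3, p0003:L60–64; Meng's
  `Hodge(X, ℚ)` read in one codimension); `Surj X Y` — there is a surjective morphism `X → Y`.
* `IsBallQuot S p` — `S` is a connected compact Shimura variety associated to `U(p,1)` in BMM's setting
  §1.1 (p0003:L1–30: `F` totally real, `E/F` CM, `V_E` Hermitian, anisotropic, signature `(p,1)` at one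
  Archimedean place and positive definite at all other infinite places, `Γ` a congruence subgroup,
  `S = Γ\X`) for OUR `E`.
* `Simple Φ` — the SIMPLE CM abelian variety `B_Φ` with CM by the subfield `K = E^{rstab Φ}` of type
  `Φ` descended to `K` (Shimura 1998 §5 Thm 1 / §8.2: the CM variety with CM by `E` of type `Φ` is
  isogenous to `B_Φ^{|rstab Φ|}`; the sealed engine's «`A_T ∼ B^{|Stab T|}`, `B` simple of dimension
  `n / 2|Stab T|`», `FaceCensusEngine.lean` §A.1, citing Milne 1999 Prop 2.1); `SimpleProd Φs` — the
  reduced product `B_red = ∏_k Simple (Φs k)` of ROUTE.md S3ᴿ; `Pow X d` — the `d`-th power;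
  `Isog X Y` — isogenous; `IsogFactorMult X Y m` — `Y^m` is an isogeny factor of `X` (`X ∼ Y^m × Z`).
* `Char` — the conjugate-symplectic automorphic characters of `𝔸_E^×/E^×` of weight one (Liu 2021
  Def 4.1 p0018:L25–27, Def 4.3 p0018:L37–39); `cmType μ` — its CM type `Φ_μ ⊆ G` (the unlabelled
  paragraph after Liu's Remark 4.2, p0018:L31–35: «there exist a CM type `Φ_μ` and a unique tuple `(m_τ)` of odd
  nonnegative integers…»; `SOURCES.md` row Liu21-CMtype);
  `Aμ μ` — Liu's `A_μ` (Def 4.5 p0018:L53–75, the CM-data bullet with `A_μ` and its CM structure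
  `i_μ : M_μ → End_E(A_μ)_ℚ` at L61–73; Prop 4.6(1) p0018:L79–82: the category of CM data is nonempty and
  connected — `A_μ` is well defined up to isogeny); `Level`, `X p K` — Liu's compactified Shimura variety
  `X_K` of the incoherent space of rank `n = p + 1` in the Compact Case (p0020:L1–5, `dim X_K = n − 1 = p`
  at L7–11); `Alb Y` — the Albanese variety (`A_K` defined at p0020:L13; the Albanese morphism and the
  pro-system L17–21).
* `WeilAlgebraic T` — S4 for the corner product `B = ∏_i A_{T i}`: the `F`-line `W_F(B) ⊆ H^{2p}(B, ℚ)`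
  consists of algebraic classes (`ROUTE.md` §1, S4).

## The clauses: each `def … : Prop` below carries the printed sentence, its store locator and its status
(printed / printed-conditional / elementary) in its own docstring; the paper-proof tables are `HOME/proofs/NIGHT1.md`.

## Two levels (the lead's ruling, INBOX L4548 (1)(b)): night-4's `RouteC.lean` types the SAME printed clauses at
ROUTE LEVEL over `HodgeRepro.Route.RouteCData` (`HodgeRepro.Route.BMM_Cor2`, `R7_printed` / `R7_codim`,
`ExistsDominantBallQuotient`, `LefschetzSymmetry`, `VanishAboveDim`; theorem `S0_of_routeC`), for an arbitrary CM
abelian variety; this file types their PER-FACE INSTANCES over `Vocab G c`, the `(G, c)` model of one Galois CM field,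
with the face's combinatorics (classes, reflex fields, codimension range) as kernel inputs.  Counterparts, clause by
clause: `Vocab.BMM2016_Cor2 p n` ↔ `Route.BMM_Cor2` (at one `(p, n)`); `Vocab.Meng2019_Lemma4_1_codim k` ↔
`Route.R7_codim` (at one `k`; night-4's `Route.R7_printed` is the all-codimension printed form, which this file does
not use — the same finding: BMM Cor 2 gives `HC_n(S)` only outside `]p/3, 2p/3[`); `Vocab.DR2015_Lemma3_5`,
`Vocab.Liu2021_Cor4_20`, `Vocab.Liu2021_Def4_5_Shimura8_3`, `Vocab.RouteC_R5` together ↔ night-4's ONE Prop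
`Route.ExistsDominantBallQuotient` (the conclusion of R0–R5 at the route's granularity; here split into the printed
clauses so that the face's reflex data enter); `Vocab.RouteC_LemmaR` has no route-level counterpart (S3ᴿ is the
face-to-`B_red` reduction); night-4's `LefschetzSymmetry` / `VanishAboveDim` (codimensions `k > g/2`) are not needed
for a rank-four face (`k = 2 ≤ g/2`).  A bridge file (night-4's `Night4RouteCBridge.lean`) relates the two levels after
both have landed.

## The theorems: `routeC_closes_face` (any finite `(G, c)`, any `SumTwo` corner family with distinct `(cls, tw)`
and `p ≥ max(3k, g)`) and its decidable-record form `FaceData.weilAlgebraic`; instances: `RouteCFaceC8Discharge.lean`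
(the first open degree-8 face, `p = 8`), `RouteCFaceC2C2C2Discharge.lean` (the sixfold `A × E × E′`, `p = 6`), and the
tables `Night1Faces8<Row>.lean` / `Night1Faces12<Row><k>.lean` (113 sealed faces).
-/

open Finset
open scoped Pointwise

namespace HodgeRepro.RouteC

/-- The abstract vocabulary of Route C for the Galois CM field `E` with group `G` and complex
conjugation `c` (see the module docstring for the meaning of each field). -/
structure Vocab (G : Type*) [Group G] [DecidableEq G] (c : G) where
  /-- smooth projective varieties over `ℂ` -/
  Var : Type
  /-- `HC X k`: every Hodge class in `H^{2k}(X, ℚ)` is algebraic -/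
  HC : Var → ℕ → Prop
  /-- `Surj X Y`: there is a surjective morphism `X → Y` -/
  Surj : Var → Var → Prop
  /-- `IsBallQuot S p`: `S` is a connected compact Shimura variety associated to `U(p,1)` for `E` (BMM §1.1) -/
  IsBallQuot : Var → ℕ → Prop
  /-- `Simple Φ`: the simple CM abelian variety with CM by `E^{rstab Φ}` of type `Φ` descended -/
  Simple : Finset G → Var
  /-- `SimpleProd Φs`: the reduced product `B_red = ∏_k Simple (Φs k)` -/
  SimpleProd : ∀ {J : Type} [Fintype J] [DecidableEq J], (J → Finset G) → Var
  /-- `Pow X d`: the `d`-th power `X^d` -/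
  Pow : Var → ℕ → Var
  /-- `Isog X Y`: `X` and `Y` are isogenous -/
  Isog : Var → Var → Prop
  /-- `IsogFactorMult X Y m`: `Y^m` is an isogeny factor of `X` -/
  IsogFactorMult : Var → Var → ℕ → Prop
  /-- conjugate-symplectic automorphic characters of `𝔸_E^×/E^×` of weight one (Liu Defs 4.1, 4.3) -/
  Char : Type
  /-- the CM type `Φ_μ ⊆ G` of `μ` (Liu Remark 4.2 / Def 4.3) -/
  cmType : Char → Finset G
  /-- `Φ_μ` is a CM type of `(G, c)` -/
  isCMType_cmType : ∀ μ, IsCMType c (cmType μ)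
  /-- Liu's CM abelian variety `A_μ` (Def 4.5, Prop 4.6(1)) -/
  Aμ : Char → Var
  /-- the open compact subgroups `K` (levels) -/
  Level : Type
  /-- Liu's compactified Shimura variety `X_K` of the incoherent space of rank `p + 1`, `dim X_K = p` -/
  X : ℕ → Level → Var
  /-- the Albanese variety -/
  Alb : Var → Var
  /-- S4 for the corner product `∏_i A (T i)`: its Weil line `W_F(B)` consists of algebraic classes -/
  WeilAlgebraic : ∀ {ι : Type} [Fintype ι], (ι → Finset G) → Prop

namespace Vocab

variable {G : Type*} [Group G] [DecidableEq G] {c : G} (V : Vocab G c)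

/-! ### The printed clauses -/

/-- **BMM 2016 Cor 2** (arXiv:1306.1515 p0003:L65–67), at the dimension `p` and the codimension `n`:
«Let `S` be a connected compact Shimura variety associated to the unitary group `U(p,1)` and let
`n ∈ [0,p] ∖ ]p/3, 2p/3[`. Then every Hodge class in `H^{2n}(S, ℚ)` is algebraic.»  Conditional as
printed (p0002:L7–9) on the stabilisation of the twisted trace formula for `GL(N) ⋊ ⟨θ⟩` (O-R2.3).
Route-level counterpart: night-4's `HodgeRepro.Route.BMM_Cor2` (all `S`, all `n`; this is its instance at one
`(p, n)`). -/
def BMM2016_Cor2 (p n : ℕ) : Prop :=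
  n ≤ p → ¬ (p < 3 * n ∧ 3 * n < 2 * p) → ∀ S, V.IsBallQuot S p → V.HC S n

/-- **R7 = Meng 2019 Lemma 4.1 (arXiv:1907.10199 p0008:L5–6) / Tankeev 2002 Cor 1.2 (p0008:L5–6),
codimension-wise**: «Let `f: X → Y` be a surjective morphism of smooth complex projective varieties. Then
`Hodge(X,ℚ)` implies `Hodge(Y,ℚ)`», in the one-codimension form given by the printed proof
(p0008:L8–17; `SOURCES.md` ME1).  Route-level counterpart: night-4's `HodgeRepro.Route.R7_codim` (all `k`; the
printed all-codimension form is its `Route.R7_printed`, not used here). -/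
def Meng2019_Lemma4_1_codim (k : ℕ) : Prop :=
  ∀ X Y, V.Surj X Y → V.HC X k → V.HC Y k

/-- **R1 = Dimitrov–Ramakrishnan 2015 Lemma 3.5** (arXiv:1401.1628 p0010:L56–57), read as the route
does: for every CM type `Φ` of `E` there is a conjugate-symplectic weight-one `μ` with `Φ_μ = Φ`.
Route-level counterpart: an input of night-4's `HodgeRepro.Route.ExistsDominantBallQuotient` (R1 in its docstring). -/
def DR2015_Lemma3_5 : Prop :=
  ∀ Φ : Finset G, IsCMType c Φ → ∃ μ : V.Char, V.cmType μ = Φ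

/-- **R3 = Liu 2021 Cor 4.20** (arXiv:2102.11518 p0023:L45–55), exhaustion form at rank `n = p + 1 ≥ 3`:
every `A_μ` is an isogeny factor of `A_K = Alb(X_K)` with multiplicity `d(μ,K)`, unbounded as `K`
shrinks.  Route-level counterpart: an input of night-4's `HodgeRepro.Route.ExistsDominantBallQuotient` (R3 + R4). -/
def Liu2021_Cor4_20 (p : ℕ) : Prop :=
  3 ≤ p + 1 → ∀ (μ : V.Char) (m : ℕ), ∃ K : V.Level, V.IsogFactorMult (V.Alb (V.X p K)) (V.Aμ μ) m

/-- **R4 = Liu 2021 Def 4.3 / Def 4.5 + Shimura 1998 §5 Props 3–4, Cor of Thm 2, §8.3** (Liu p0018:L37–42,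
L48, L53–75; Shimura p0048:L1–5, p0048:L13, p0053:L8, p0083:L9): `A_μ` is isogenous to a power of the
simple CM variety of type `(M'_μ, Ψ_μ)` = (reflex field, reflex type) of `(E, Φ_μ)` — on the model
`Simple (liuType (cmType μ))`, since `M'_μ = E^{Stab Φ_μ} = E^{rstab Φ_μ⁻¹}` (`rstab_liuType`) and `Ψ_μ`
lifted to `E` is `Φ_μ⁻¹`.  Route-level counterpart: an input of night-4's
`HodgeRepro.Route.ExistsDominantBallQuotient` (R0 / R4: Shimura §8.3 in its docstring). -/
def Liu2021_Def4_5_Shimura8_3 : Prop :=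
  ∀ μ : V.Char, ∃ d : ℕ, 1 ≤ d ∧ V.Isog (V.Aμ μ) (V.Pow (V.Simple (liuType (V.cmType μ))) d)

/-- **R5 (dominance)** — the route's elementary lemma (ROUTE.md §4 item 1, Appendix A4 Lemma W; analytic
core kernel-checked in `RouteCFormR5` / `BallGenLemmaW` / `ZariskiLemmaWBlocks`; paper residue ROUTE-C
13.2(a)(c)): under R0's standing hypothesis `[E⁺ : ℚ] ≥ 2`, i.e. `|G| ≥ 4` (so that the Hermitian space of
signature `(p,1)` at one place and definite at the others is anisotropic and the Shimura varieties compact —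
ROUTE.md §4 item 1 R0, p2 `MuTableSignsHermitian.exists_hermitian_sigP1_posDef_anisotropic`), if each simple
factor of `B_red = ∏_k Simple (Φ k)` is an Albanese factor of `X_K` with unbounded multiplicity and
`dim B_red = Σ_k |G| / (2 |rstab (Φ k)|) ≤ p`, then a connected component `S′` of some `X_K` — a connected
compact Shimura variety of `U(p,1)` — maps onto `B_red`.  Route-level counterpart: the conclusion of night-4's
`HodgeRepro.Route.ExistsDominantBallQuotient` (R5 in its docstring), here for `B_red` of the face with its
factors' multiplicities as the hypothesis. -/
def RouteC_R5 (p : ℕ) : Prop :=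
  4 ≤ Nat.card G →
  ∀ {J : Type} [Fintype J] [DecidableEq J] (Φ : J → Finset G),
    (∀ k, IsCMType c (Φ k)) →
    (∀ (k : J) (m : ℕ), ∃ K : V.Level, V.IsogFactorMult (V.Alb (V.X p K)) (V.Simple (Φ k)) m) →
    (∑ k, Nat.card G / (2 * Nat.card (rstab (Φ k)))) ≤ p →
    ∃ S, V.IsBallQuot S p ∧ V.Surj S (V.SimpleProd Φ)

/-- **Lemma R (S3ᴿ)** — ROUTE.md §1 (lead, unprinted, routine; combinatorial core KERNEL,
`isHodgeSetOn_cosetMap_reducedSet`): for a corner product `B = ∏_i A (T i)` with `T i = Φ (cls i) · tw i`,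
distinct `(cls i, tw i)`, whose reduced sets `U_s` embed in the coset `G`-set of `B_red = ∏_k Simple (Φ k)`
as Pohlmann sets of its type `cosetType Φ` (so the `s`-lines of `W_F(B)` are codimension-`k` Hodge lines
on `B_red`, `2k = |ι|`): HC for `B_red` in codimension `k` ⇒ `W_F(B)` algebraic.  No route-level counterpart
(the face-to-`B_red` reduction S3ᴿ is below the granularity of night-4's `RouteC.lean`). -/
def RouteC_LemmaR : Prop :=
  ∀ {ι J : Type} [Fintype ι] [DecidableEq ι] [Fintype J] [DecidableEq J]
    (Φ : J → Finset G) (cls : ι → J) (tw : ι → G),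
    (∀ k, IsCMType c (Φ k)) →
    Function.Injective (fun i => (cls i, tw i)) →
    (∀ s : G, Set.InjOn (cosetMap Φ) (reducedSet cls tw s)) →
    (∀ s : G, IsHodgeSetOn c (cosetType Φ) ((reducedSet cls tw s).image (cosetMap Φ))) →
    V.HC (V.SimpleProd Φ) (Fintype.card ι / 2) →
    V.WeilAlgebraic (corner Φ cls tw)

/-- Isogeny bookkeeping (elementary): if `Y ∼ Z^d` with `d ≥ 1` and `Y^m` is an isogeny factor of `X`,
then `Z^m` is an isogeny factor of `X`. -/
def IsogFactorMult_of_isog_pow : Prop :=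
  ∀ X Y Z (d m : ℕ), 1 ≤ d → V.Isog Y (V.Pow Z d) → V.IsogFactorMult X Y m → V.IsogFactorMult X Z m

/-- The bundle of clauses Route C uses for a corner product of dimension `≤ p` in codimension `k`. -/
structure Clauses (p k : ℕ) : Prop where
  /-- BMM Cor 2 at `(p, k)` -/
  bmm : V.BMM2016_Cor2 p k
  /-- R7 in codimension `k` -/
  meng : V.Meng2019_Lemma4_1_codim k
  /-- DR Lemma 3.5 -/
  dr : V.DR2015_Lemma3_5
  /-- Liu Cor 4.20 at rank `p + 1` -/
  liu : V.Liu2021_Cor4_20 p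
  /-- Liu Def 4.5 + Shimura §8.3 -/
  liuShimura : V.Liu2021_Def4_5_Shimura8_3
  /-- R5 at dimension `p` -/
  r5 : V.RouteC_R5 p
  /-- Lemma R -/
  lemmaR : V.RouteC_LemmaR
  /-- isogeny bookkeeping -/
  isog : V.IsogFactorMult_of_isog_pow

/-! ### The discharge -/

/-- **R1 + R3 + R4 on one representative** — for a CM type `Φ` of `E` (primitive or lifted): DR Lemma 3.5
gives `μ` with `Φ_μ = Φ⁻¹` (a CM type, `isCMType_liuType`); its reflex data are `(E^{rstab Φ}, Φ)`
(`rstab_liuType`, `liuType_liuType`), so `A_μ ∼ Simple(Φ)^d`, and Liu Cor 4.20 makes `Simple Φ` an Albanese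
factor of `X_K` with unbounded multiplicity. -/
theorem albFactor_simple {p : ℕ} (hc : IsComplexConj c) (hn : 3 ≤ p + 1)
    (hdr : V.DR2015_Lemma3_5) (hliu : V.Liu2021_Cor4_20 p) (hls : V.Liu2021_Def4_5_Shimura8_3)
    (hisog : V.IsogFactorMult_of_isog_pow) {Φ : Finset G} (hΦ : IsCMType c Φ) (m : ℕ) :
    ∃ K : V.Level, V.IsogFactorMult (V.Alb (V.X p K)) (V.Simple Φ) m := by
  obtain ⟨μ, hμ⟩ := hdr (liuType Φ) (isCMType_liuType hc hΦ)
  obtain ⟨d, hd, hAμ⟩ := hls μ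
  rw [hμ, liuType_liuType] at hAμ
  obtain ⟨K, hK⟩ := hliu hn μ m
  exact ⟨K, hisog _ _ _ d m hd hAμ hK⟩

/-- **The face discharge** (closer C5′ on a corner product).  For `(G, c)` finite, representatives
`Φ : J → Finset G` (CM types), corners `T i = Φ (cls i) · tw i` with `SumTwo`, distinct `(cls i, tw i)`
and `cosetMap Φ` injective on the reduced sets, `[E⁺ : ℚ] ≥ 2` (R0: `|G| ≥ 4`), codimension `k = |ι|/2`,
`g = dim B_red ≤ p`, `3k ≤ p` and Liu's `n = p + 1 ≥ 3`: the printed clauses imply that the Weil line of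
`B = ∏_i A (T i)` is algebraic.  Chain: R1+R3+R4 (`albFactor_simple`) ⇒ R5 gives `S′ ↠ B_red` ⇒ BMM Cor 2 gives HC for `S′`
in codimension `k` ⇒ R7 transfers it to `B_red` ⇒ Lemma R (core: `isHodgeSetOn_cosetMap_reducedSet`)
gives `W_F(B)` algebraic. -/
theorem routeC_closes_face (hc : IsComplexConj c) {ι J : Type} [Fintype ι] [DecidableEq ι]
    [Fintype J] [DecidableEq J] (Φ : J → Finset G) (cls : ι → J) (tw : ι → G)
    (hΦ : ∀ k, IsCMType c (Φ k)) (hsum : SumTwo (corner Φ cls tw))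
    (hinj : Function.Injective fun i => (cls i, tw i))
    (hρ : ∀ s : G, Set.InjOn (cosetMap Φ) (reducedSet cls tw s)) (h0 : 4 ≤ Nat.card G)
    {p : ℕ} (hg : (∑ k, Nat.card G / (2 * Nat.card (rstab (Φ k)))) ≤ p)
    (hk : 3 * (Fintype.card ι / 2) ≤ p) (hn : 3 ≤ p + 1)
    (H : V.Clauses p (Fintype.card ι / 2)) :
    V.WeilAlgebraic (corner Φ cls tw) := by
  -- R1 + R3 + R4: every simple factor is an Albanese factor with unbounded multiplicity
  have halb : ∀ (k : J) (m : ℕ), ∃ K : V.Level, V.IsogFactorMult (V.Alb (V.X p K)) (V.Simple (Φ k)) m :=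
    fun k m => V.albFactor_simple hc hn H.dr H.liu H.liuShimura H.isog (hΦ k) m
  -- R5: a connected compact ball quotient of dimension `p` mapping onto `B_red`
  obtain ⟨S, hS, hsurj⟩ := H.r5 h0 Φ hΦ halb hg
  -- R6 = BMM Cor 2 on `S` in codimension `k`
  have hrange : ¬ (p < 3 * (Fintype.card ι / 2) ∧ 3 * (Fintype.card ι / 2) < 2 * p) :=
    fun h => absurd hk (not_le.2 h.1)
  have hkp : Fintype.card ι / 2 ≤ p := by omega
  have hHC_S : V.HC S (Fintype.card ι / 2) := H.bmm hkp hrange S hS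
  -- R7: transfer to `B_red`
  have hHC_B : V.HC (V.SimpleProd Φ) (Fintype.card ι / 2) := H.meng S (V.SimpleProd Φ) hsurj hHC_S
  -- Lemma R: the Weil line of the corner product (combinatorial core on the kernel)
  have hU : ∀ s : G, IsHodgeSetOn c (cosetType Φ) ((reducedSet cls tw s).image (cosetMap Φ)) :=
    fun s => isHodgeSetOn_cosetMap_reducedSet hc Φ cls tw hinj hsum s (hρ s)
  exact H.lemmaR Φ cls tw hΦ hinj hρ hU hHC_B

end Vocab



/-! ## Face records: a decidable record of a rank-four face with its class decomposition, and the generic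
discharge for such a record (merged from `Night1FaceData.lean` to keep the import depth at 1 behind
`RouteCReflexModel` / `RouteCCosetModel` — the farm's olean lag, INBOX L4598)

To run Route C over a whole census (the 25 sealed degree-8 and the 88 sealed degree-12 representatives, files
`Night1Faces8<Row>.lean` / `Night1Faces12<Row><k>.lean`), each face is recorded as a `FaceData`: the sealed face
`(Φ; p, p′)`, its class representatives `reps`, class map `cls`, twists `tw` and the orders `stabOrder k` of the
right stabilisers of the representatives.  `FaceData.Ok` is the conjunction of the decidable checks the generic
theorem needs (every corner a CM type, distinct places, `faceCorners = corner reps cls tw`, distinct corners,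
distinct `(cls, tw)`), so that ONE `decide` per face certifies it; `FaceData.StabOrderOk` checks the stabiliser
orders.  `FaceData.weilAlgebraic` then needs only the numbers `|G| ≥ 4`, `g = Σ_k |G| / (2 · stabOrder k) ≤ p`
and `6 ≤ p`.  Two general facts make the per-face work small: typer's `sumTwo_faceCorners` (every face is
`SumTwo`) and `injOn_cosetMap_reducedSet_of_injective` (for DISTINCT corners the coset map of `B_red` is injective
on every reduced set — two corners of the same class give the same coset of `rstab (Φ k)` iff they are equal,
`rmul_rmul`). -/

section FaceRecords

variable {G : Type*} [Group G] [DecidableEq G]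

omit [DecidableEq G] in
/-- Two corners `Φ (cls i) · tw i`, `Φ (cls i′) · tw i′` of the same class give the same coset of
`rstab (Φ k)` in the reduced set iff they are equal. -/
theorem corner_eq_of_cosetMap_eq {ι J : Type*} (Φ : J → Finset G) (cls : ι → J) (tw : ι → G)
    (s : G) {i i' : ι} (h : cosetMap Φ (cls i, s * (tw i)⁻¹) = cosetMap Φ (cls i', s * (tw i')⁻¹)) :
    corner Φ cls tw i = corner Φ cls tw i' := by
  have h1 : cls i = cls i' := congrArg Sigma.fst h
  unfold corner
  rw [← h1] at h ⊢
  have h2 := (cosetMap_eq_iff Φ (cls i) _ _).1 h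
  rw [mem_rstab] at h2
  have h3 : (s * (tw i)⁻¹)⁻¹ * (s * (tw i')⁻¹) = tw i * (tw i')⁻¹ := by group
  rw [h3] at h2
  calc rmul (Φ (cls i)) (tw i) = rmul (rmul (Φ (cls i)) (tw i * (tw i')⁻¹)) (tw i') := by
        rw [rmul_rmul, inv_mul_cancel_right]
    _ = rmul (Φ (cls i)) (tw i') := by rw [h2]

/-- **For distinct corners the coset map is injective on every reduced set**: Lemma R's injectivity
hypothesis on the CM-algebra side is automatic for a face with four distinct corners. -/
theorem injOn_cosetMap_reducedSet_of_injective {ι J : Type*} [Fintype ι] [DecidableEq J]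
    (Φ : J → Finset G) (cls : ι → J) (tw : ι → G) (hinj : Function.Injective (corner Φ cls tw))
    (s : G) : Set.InjOn (cosetMap Φ) (reducedSet cls tw s) := by
  intro a ha b hb hab
  rw [Finset.mem_coe, mem_reducedSet] at ha hb
  obtain ⟨i, rfl⟩ := ha
  obtain ⟨i', rfl⟩ := hb
  have := hinj (corner_eq_of_cosetMap_eq Φ cls tw s hab)
  rw [this]

/-- A rank-four face with its class decomposition: the sealed face `(Φ; p, p′)`, the class representatives
`reps : Fin J → Finset G`, the class map and twists (`T i = reps (cls i) · tw i`) and the orders of the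
representatives' right stabilisers. -/
structure FaceData (G : Type*) [Group G] where
  /-- the CM type of the face -/
  Φ : Finset G
  /-- the first place -/
  p : G
  /-- the second place -/
  p' : G
  /-- the number of isogeny classes -/
  J : ℕ
  /-- the class representatives -/
  reps : Fin J → Finset G
  /-- the class of each corner -/
  cls : Fin 4 → Fin J
  /-- the twist of each corner -/
  tw : Fin 4 → G
  /-- the orders of the right stabilisers of the representatives -/
  stabOrder : Fin J → ℕ

namespace FaceData

variable [Fintype G] (c : G) (D : FaceData G)

/-- The face `faceCorners c Φ p p′`. -/
def face : Fin 4 → Finset G := faceCorners c D.Φ D.p D.p'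

/-- The decidable checks: `Φ` and the representatives are CM types, the places are distinct, the corners
are `reps (cls i) · tw i`, the four corners are distinct, the pairs `(cls i, tw i)` are distinct. -/
def Ok : Prop :=
  IsCMType c D.Φ ∧ (∀ k, IsCMType c (D.reps k)) ∧ D.p' ∉ place c D.p ∧
    faceCorners c D.Φ D.p D.p' = corner D.reps D.cls D.tw ∧
    Function.Injective (faceCorners c D.Φ D.p D.p') ∧ Function.Injective (fun i => (D.cls i, D.tw i))

/-- `Ok` is decidable. -/
instance : Decidable (D.Ok c) := by unfold Ok; infer_instance

/-- The stabiliser orders are as recorded. -/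
def StabOrderOk : Prop := ∀ k, Fintype.card (rstab (D.reps k)) = D.stabOrder k

/-- `StabOrderOk` is decidable. -/
instance : Decidable D.StabOrderOk := by unfold StabOrderOk; infer_instance

/-- `g = dim B_red = Σ_k |G| / (2 · stabOrder k)`. -/
def dimBred : ℕ := ∑ k, Fintype.card G / (2 * D.stabOrder k)

/-- The recorded dimension is the one the clauses use. -/
theorem sum_dim_eq (hs : D.StabOrderOk) :
    (∑ k, Nat.card G / (2 * Nat.card (rstab (D.reps k)))) = D.dimBred := by
  unfold dimBred
  refine Finset.sum_congr rfl fun k _ => ?_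
  rw [Nat.card_eq_fintype_card, Nat.card_eq_fintype_card, hs k]

/-- **The generic discharge**: for a face record with `Ok` and `StabOrderOk`, `|G| ≥ 4` (R0: `[E⁺ : ℚ] ≥ 2`),
`g ≤ p` and `6 ≤ p` (BMM's range at `k = 2`; it also gives Liu's `n = p + 1 ≥ 3`), the printed clauses at
`(p, 2)` imply that the Weil line of the corner product is algebraic. -/
theorem weilAlgebraic (hc : IsComplexConj c) (V : Vocab G c) (hok : D.Ok c) (hs : D.StabOrderOk)
    (h0 : 4 ≤ Fintype.card G) {p : ℕ} (hg : D.dimBred ≤ p) (hk : 6 ≤ p) (H : V.Clauses p 2) :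
    V.WeilAlgebraic (D.face c) := by
  obtain ⟨hΦ, hreps, hp, hface, hcinj, hinj⟩ := hok
  unfold face
  rw [hface]
  have H' : V.Clauses p (Fintype.card (Fin 4) / 2) := by simpa using H
  refine V.routeC_closes_face hc D.reps D.cls D.tw hreps (hface ▸ sumTwo_faceCorners hc hΦ hp) hinj
    (injOn_cosetMap_reducedSet_of_injective D.reps D.cls D.tw (hface ▸ hcinj))
    (by rw [Nat.card_eq_fintype_card]; exact h0) (p := p) ?_ ?_ ?_ H'
  · rw [D.sum_dim_eq hs]; exact hg
  · simpa using hk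
  · omega

end FaceData


end FaceRecords

end HodgeRepro.RouteC
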